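import Summits.BirchSwinnertonDyer.BirchSwinnertonDyer.Theorems.ThetaPartnerAtTwoSignedMainConjectureCMTwoRankZeroUpToTwoPower
import Summits.BirchSwinnertonDyer.BirchSwinnertonDyer.Theorems.ThetaPartnerAtTwoSignedControlAtTwoPlusCyclicLayersOfHonda
import Summits.BirchSwinnertonDyer.BirchSwinnertonDyer.Theorems.ThetaPartnerAtTwoSignedControlAtTwoPlusLocKummerOfHonda
import Summits.BirchSwinnertonDyer.BirchSwinnertonDyer.Theorems.ThetaPartnerAtTwoSignedControlAtTwoLocalNonDivTwo
import HarnessLib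

/-!
# Route `ThetaPartnerAtTwo` (TP2), crux K2r0 `SignedMainConjectureCMTwoRankZero` (stmt-BirchSwinnertonDyer-20312),
# line `rankzero` v10: the three local statements at `2` collapse to ONE — a plus Honda system at `2` for `A` (HONDA⁺@2) —
# LEV0@2 being a THEOREM for every elliptic curve over `ℚ`

HONEST FRAMING (cell `pub/bsd-wall`, W-ALL row 1, lead prover `bsd-wall-tp2-p2` g4). Nothing here is the crux and BSD is not
proved by any of this. The K4 seats (tp2-p3 g2, w2, w3) landed on 2026-08-27/28 the per-curve doors
`SignedEC.plusCyclicLayers_two_of_honda` (CYC⁺@2 ⟸ HONDA⁺@2, p585450), `SignedEC.plusLocKummer_two_of_honda` (LOC⁺@2 ⟸ HONDA⁺@2,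
p586433) and the THEOREM `SignedEC.exists_mem_localLayerPointsOfEmb_zero_ne_two_nsmul` (LEV0@2 for every elliptic `W/ℚ`,
p585289); K4's line `eulerchar` v6 accordingly has ONE research stub `stub_plusHondaSystemTwo`. THIS FILE reads them for the CM
partner `A` and composes with this seat's doors (p585652 `…RankZeroOfLocal`, p587266 `…RankZeroUpToTwoPower`):

* `signedMainConjectureCMTwoRankZero_at_unitZone_of_honda` — UNIT ZONE (`2 ∤ #Ш(A)·∏c_ℓ(A)`): PUB + HONDA⁺@2(A) ⇒ both conjuncts
  of the crux AT `A`. So at a unit-zone partner the whole signed main conjecture at `2` is ONE local statement about the formal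
  group of `A` at `2` (Honda type `T² + 2`) plus print.
* `signedMainConjectureCMTwoRankZero_at_of_honda_of_upToTwoPower` — any `A` on the row: PUB + HONDA⁺@2(A) + (MC±2^k)_A (Kobayashi's
  `+` main conjecture at `2` modulo powers of `2`) + (μ♭)_A ⇒ both conjuncts AT `A`.
HONDA⁺@2(A) is VERBATIM the body of K4's registered `stub_plusHondaSystemTwo` with `A` for `W` (a family `d_m ∈ E(ℚ_{2,m}·ℚ_v)` with
`Tr_{m+2/m+1} d_{m+2} = −d_m`, generating each layer modulo the previous one and modulo `2`, `d_0` generating `E(ℚ_v)/2`);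
it does not see CM (same supersingular formal group type). Every research input is a displayed binder.

References: [Kobayashi2003] §8.4 (Lemma 8.9, Props. 8.11–8.12), Thm. 9.3; [Sprung2012] Thm. 2.2; [BDKim2013] Cor. 3.15,
Props. 2.2–2.3; [GreenbergLNM1716] §4; [BurungaleFlach2024] Thm. 1.1; [MilneADT2006] I Lemma 3.3; [PollackRubin2004] Thm. 7.3 (p > 2).
-/

set_option autoImplicit false
-- the Theorems namespace of this sub repeats the summit name by design (D-0017 nested layout)
set_option linter.dupNamespace false

noncomputable section

open scoped Classical NumberField MatrixGroups ModularForm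

open NumberField IsDedekindDomain CongruenceSubgroup

namespace Summit.BirchSwinnertonDyer.BirchSwinnertonDyer.Theorems

open Literature.NumberTheory.EllipticCurves Literature.NumberTheory.GaloisRepresentations
  WeierstrassCurve ZpExtension Literature.NumberTheory.EllipticCurves.Kobayashi2003
  Literature.NumberTheory.EllipticCurves.IwasawaDual Literature.NumberTheory.EllipticCurves.GreenbergVatsal2000
  Literature.NumberTheory.EllipticCurves.ModularForms Literature.NumberTheory.EllipticCurves.Rank1Residual
  Literature.NumberTheory.EllipticCurves.Rank1Residual.Typed
  Summit.BirchSwinnertonDyer.Rank1Residual Summit.BirchSwinnertonDyer.Rank1Residual.Supersingular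

variable (A : WeierstrassCurve ℚ) [A.IsElliptic] [A.IsGloballyMinimal]

/-! ## §1. CYC⁺@2(A) and LOC⁺@2(A) from HONDA⁺@2(A); LEV0@2(A) outright -/

section Local

variable {A}

/-- CYC⁺@2 read for `A` from a plus Honda system at `2` for `A` (K4's door `SignedEC.plusCyclicLayers_two_of_honda`, any curve good
supersingular at `2`). [cite: Kobayashi2003, §8.4 (Prop. 8.11, Prop. 8.12)] [cite: Sprung2012, Thm. 2.2 (2′)] -/
theorem plusCyclicLayersCMTwo_at_of_honda (hss : GoodSS A 2)
    (hhonda : ∀ (κ : ZpExtension ℚ 2), κ.IsCyclotomic →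
      ∀ (v : HeightOneSpectrum (𝓞 ℚ)), (2 : 𝓞 ℚ) ∈ v.asIdeal →
      ∃ d : ℕ → localPoints A (v.adicCompletion ℚ),
        (∀ m, d m ∈ localLayerPointsOfEmb κ (closureEmb (K := ℚ) (v.adicCompletion ℚ)) A m) ∧
        (∀ m, localTraceOfEmb κ (closureEmb (K := ℚ) (v.adicCompletion ℚ)) A (m + 1) (m + 2) (d (m + 2)) = -d m) ∧
        (∀ m : ℕ, 1 ≤ m → ∀ P ∈ localLayerPointsOfEmb κ (closureEmb (K := ℚ) (v.adicCompletion ℚ)) A m,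
          ∃ B ∈ AddSubgroup.closure (Set.range fun σ : Field.absoluteGaloisGroup (v.adicCompletion ℚ) ↦ σ • d m),
            ∃ P' ∈ localLayerPointsOfEmb κ (closureEmb (K := ℚ) (v.adicCompletion ℚ)) A (m - 1),
            ∃ R ∈ localLayerPointsOfEmb κ (closureEmb (K := ℚ) (v.adicCompletion ℚ)) A m, P = B + P' + 2 • R) ∧
        (∀ P ∈ localLayerPointsOfEmb κ (closureEmb (K := ℚ) (v.adicCompletion ℚ)) A 0,
          ∃ a : ℤ, ∃ R ∈ localLayerPointsOfEmb κ (closureEmb (K := ℚ) (v.adicCompletion ℚ)) A 0, P = a • d 0 + 2 • R)) :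
    ∀ (κ : ZpExtension ℚ 2), κ.IsCyclotomic →
      ∀ (v : HeightOneSpectrum (𝓞 ℚ)), (2 : 𝓞 ℚ) ∈ v.asIdeal →
      ∀ n : ℕ, ∃ d ∈ signedLocalPoints κ (v.adicCompletion ℚ) A 1 n,
        ∀ x ∈ signedLocalPoints κ (v.adicCompletion ℚ) A 1 n,
        ∃ B ∈ AddSubgroup.closure (Set.range fun σ : Field.absoluteGaloisGroup (v.adicCompletion ℚ) ↦ σ • d),
          ∃ b ∈ signedLocalPoints κ (v.adicCompletion ℚ) A 1 n, x = B + 2 • b := by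
  intro κ hκ v hv
  obtain ⟨d, hd, htr, hgen, hgen0⟩ := hhonda κ hκ v hv
  exact SignedEC.plusCyclicLayers_two_of_honda A hss hκ v hv d hd htr hgen hgen0

/-- LOC⁺@2 read for `A` from a plus Honda system at `2` for `A` (K4's door `SignedEC.plusLocKummer_two_of_honda`).
[cite: GreenbergLNM1716, §4 Lemma 4.7 (pp. 107–108)] [cite: BDKim2013, Props. 2.2–2.3] -/
theorem plusLocKummerCMTwo_at_of_honda (hss : GoodSS A 2)
    (hhonda : ∀ (κ : ZpExtension ℚ 2), κ.IsCyclotomic →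
      ∀ (v : HeightOneSpectrum (𝓞 ℚ)), (2 : 𝓞 ℚ) ∈ v.asIdeal →
      ∃ d : ℕ → localPoints A (v.adicCompletion ℚ),
        (∀ m, d m ∈ localLayerPointsOfEmb κ (closureEmb (K := ℚ) (v.adicCompletion ℚ)) A m) ∧
        (∀ m, localTraceOfEmb κ (closureEmb (K := ℚ) (v.adicCompletion ℚ)) A (m + 1) (m + 2) (d (m + 2)) = -d m) ∧
        (∀ m : ℕ, 1 ≤ m → ∀ P ∈ localLayerPointsOfEmb κ (closureEmb (K := ℚ) (v.adicCompletion ℚ)) A m,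
          ∃ B ∈ AddSubgroup.closure (Set.range fun σ : Field.absoluteGaloisGroup (v.adicCompletion ℚ) ↦ σ • d m),
            ∃ P' ∈ localLayerPointsOfEmb κ (closureEmb (K := ℚ) (v.adicCompletion ℚ)) A (m - 1),
            ∃ R ∈ localLayerPointsOfEmb κ (closureEmb (K := ℚ) (v.adicCompletion ℚ)) A m, P = B + P' + 2 • R) ∧
        (∀ P ∈ localLayerPointsOfEmb κ (closureEmb (K := ℚ) (v.adicCompletion ℚ)) A 0,
          ∃ a : ℤ, ∃ R ∈ localLayerPointsOfEmb κ (closureEmb (K := ℚ) (v.adicCompletion ℚ)) A 0, P = a • d 0 + 2 • R)) :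
    ∀ (κ : ZpExtension ℚ 2), κ.IsCyclotomic →
      ∀ t : A.subgroupH1 2 κ.kerSubgroup,
        (∀ σ : Field.absoluteGaloisGroup ℚ, A.conjH1 2 κ.kerSubgroup σ t - t ∈ signedSelmerInfty A κ 1) →
        ∀ w : HeightOneSpectrum (𝓞 ℚ), ((2 : ℕ) : 𝓞 ℚ) ∈ w.asIdeal →
        ∃ xw : discreteH1 (localSubgroup (⊤ : Subgroup (Field.absoluteGaloisGroup ℚ)) (w.adicCompletion ℚ))
            (localPoints A (w.adicCompletion ℚ)),
          (∃ k : ℕ, 2 ^ k • xw = 0) ∧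
          ∀ y : A.subgroupH1 2 (⊤ : Subgroup (Field.absoluteGaloisGroup ℚ)),
            A.localResOver 2 ⊤ (w.adicCompletion ℚ) y = xw →
            t - A.resOfLe 2 (le_top : κ.kerSubgroup ≤ ⊤) y ∈
              localKummerOverOfEmb A 2 κ.kerSubgroup (closureEmb (K := ℚ) (w.adicCompletion ℚ))
                (⨆ n, signedLocalPoints κ (w.adicCompletion ℚ) A 1 n) :=
  fun κ hκ t ht w hw ↦ SignedEC.plusLocKummer_two_of_honda A hss hκ (hhonda κ hκ) t ht w hw

omit [A.IsGloballyMinimal] in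
/-- LEV0@2 read for `A`: a THEOREM for every elliptic curve over `ℚ` (K4 seat w3's
`SignedEC.exists_mem_localLayerPointsOfEmb_zero_ne_two_nsmul`, Milne ADT I Lemma 3.3). [cite: MilneADT2006, I Lemma 3.3] -/
theorem localNonDivCMTwo_at :
    ∀ (κ : ZpExtension ℚ 2), κ.IsCyclotomic →
      ∀ (v : HeightOneSpectrum (𝓞 ℚ)), (2 : 𝓞 ℚ) ∈ v.asIdeal →
      ∃ m₀ ∈ localLayerPointsOfEmb κ (closureEmb (K := ℚ) (v.adicCompletion ℚ)) A 0,
        ∀ b ∈ localLayerPointsOfEmb κ (closureEmb (K := ℚ) (v.adicCompletion ℚ)) A 0, m₀ ≠ 2 • b :=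
  fun κ _ v hv ↦ SignedEC.exists_mem_localLayerPointsOfEmb_zero_ne_two_nsmul A κ v hv

end Local

/-! ## §2. The crux AT `A` from HONDA⁺@2(A) + PUB (unit zone) / + (MC±2^k)_A + (μ♭)_A (any `A`) -/

/-- **K2r0 AT a unit-zone CM curve is ONE local statement + print.** `A/ℚ` CM, globally minimal, analytic rank `0`, good
supersingular at `2`, `a₂ = 0`, `2 ∤ #Ш(A)·∏c_ℓ(A)`; grant PUB (Burungale–Flach, modularity, GZK, the `p = 2` period fact, Greenberg's
five facts) BY NAME and a plus Honda system at `2` for `A` (HONDA⁺@2(A), K4's registered stub body read for `A`). Then both conjuncts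
of the crux hold AT `A`. [cite: Kobayashi2003, §8.4, Thm. 9.3] [cite: BurungaleFlach2024, Thm. 1.1] [cite: BDKim2013, Cor. 3.15] -/
theorem signedMainConjectureCMTwoRankZero_at_unitZone_of_honda
    (hBF : bsdTriple_of_hasCM_of_L_one_ne_zero)
    (hmod : nonempty_modularParametrizationData) (hLrat : hasEntireLFunction_rat)
    (hGZK : rank_eq_analyticRank_of_analyticRank_le_one)
    (h2 : Literature.NumberTheory.EllipticCurves.realPeriodRat_eq_unit_mul_plusPeriod_two)
    (hC : Greenberg1999.casselsSurjectivity_H1Sigma ℚ)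
    (h412 : Greenberg1999.prop412_noFiniteSubmodule_H1Sigma_of_rank_one)
    (hcork : Greenberg1999.h1Sigma_zpCorank_le_degree ℚ)
    (hP108 : Greenberg1999.localQuotient_restriction_surjective ℚ)
    (hWL : Greenberg1999.h1SigmaInfty_rank_eq_one)
    (hcm : A.HasCM) (hr : A.analyticRank = 0) (hss : GoodSS A 2) (ha : A.frobeniusTrace 2 = 0)
    (hunit : ¬ 2 ∣ A.shaOrder * A.tamagawaProduct)
    (hhonda : ∀ (κ : ZpExtension ℚ 2), κ.IsCyclotomic →
      ∀ (v : HeightOneSpectrum (𝓞 ℚ)), (2 : 𝓞 ℚ) ∈ v.asIdeal →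
      ∃ d : ℕ → localPoints A (v.adicCompletion ℚ),
        (∀ m, d m ∈ localLayerPointsOfEmb κ (closureEmb (K := ℚ) (v.adicCompletion ℚ)) A m) ∧
        (∀ m, localTraceOfEmb κ (closureEmb (K := ℚ) (v.adicCompletion ℚ)) A (m + 1) (m + 2) (d (m + 2)) = -d m) ∧
        (∀ m : ℕ, 1 ≤ m → ∀ P ∈ localLayerPointsOfEmb κ (closureEmb (K := ℚ) (v.adicCompletion ℚ)) A m,
          ∃ B ∈ AddSubgroup.closure (Set.range fun σ : Field.absoluteGaloisGroup (v.adicCompletion ℚ) ↦ σ • d m),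
            ∃ P' ∈ localLayerPointsOfEmb κ (closureEmb (K := ℚ) (v.adicCompletion ℚ)) A (m - 1),
            ∃ R ∈ localLayerPointsOfEmb κ (closureEmb (K := ℚ) (v.adicCompletion ℚ)) A m, P = B + P' + 2 • R) ∧
        (∀ P ∈ localLayerPointsOfEmb κ (closureEmb (K := ℚ) (v.adicCompletion ℚ)) A 0,
          ∃ a : ℤ, ∃ R ∈ localLayerPointsOfEmb κ (closureEmb (K := ℚ) (v.adicCompletion ℚ)) A 0, P = a • d 0 + 2 • R)) :
    (∀ (κ : ZpExtension ℚ 2) (γ : Field.absoluteGaloisGroup ℚ), κ.IsCyclotomic → κ.IsTopGenerator γ →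
      ∀ D : SignedSelmerDualData A κ γ 1, Module.IsTorsion (IwasawaAlgebra 2) D.X ∧ D.mu = 0) ∧
    KobayashiMainConjecture A 2 1 :=
  signedMainConjectureCMTwoRankZero_at_unitZone_of_local A hBF hmod hLrat hGZK h2 hC h412 hcork hP108 hWL hcm hr hss ha hunit
    (localNonDivCMTwo_at (A := A)) (plusCyclicLayersCMTwo_at_of_honda hss hhonda) (plusLocKummerCMTwo_at_of_honda hss hhonda)

/-- **K2r0 AT `A` from HONDA⁺@2(A) + PUB + the main conjecture modulo powers of `2` + analytic `μ = 0`.** As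
`signedMainConjectureCMTwoRankZero_at_of_local_of_upToTwoPower` (p587266) with the three local binders replaced by the single
HONDA⁺@2(A). [cite: PollackRubin2004, Thm. 7.3 (p > 2)] [cite: Kobayashi2003, §8.4, Thm. 9.3] [cite: BurungaleFlach2024, Thm. 1.1 and Remark 7] -/
theorem signedMainConjectureCMTwoRankZero_at_of_honda_of_upToTwoPower
    (hBF : bsdTriple_of_hasCM_of_L_one_ne_zero)
    (hmod : nonempty_modularParametrizationData) (hLrat : hasEntireLFunction_rat)
    (hGZK : rank_eq_analyticRank_of_analyticRank_le_one)
    (h2 : Literature.NumberTheory.EllipticCurves.realPeriodRat_eq_unit_mul_plusPeriod_two)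
    (hC : Greenberg1999.casselsSurjectivity_H1Sigma ℚ)
    (h412 : Greenberg1999.prop412_noFiniteSubmodule_H1Sigma_of_rank_one)
    (hcork : Greenberg1999.h1Sigma_zpCorank_le_degree ℚ)
    (hP108 : Greenberg1999.localQuotient_restriction_surjective ℚ)
    (hWL : Greenberg1999.h1SigmaInfty_rank_eq_one)
    (hcm : A.HasCM) (hr : A.analyticRank = 0) (hss : GoodSS A 2) (ha : A.frobeniusTrace 2 = 0)
    (hhonda : ∀ (κ : ZpExtension ℚ 2), κ.IsCyclotomic →
      ∀ (v : HeightOneSpectrum (𝓞 ℚ)), (2 : 𝓞 ℚ) ∈ v.asIdeal →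
      ∃ d : ℕ → localPoints A (v.adicCompletion ℚ),
        (∀ m, d m ∈ localLayerPointsOfEmb κ (closureEmb (K := ℚ) (v.adicCompletion ℚ)) A m) ∧
        (∀ m, localTraceOfEmb κ (closureEmb (K := ℚ) (v.adicCompletion ℚ)) A (m + 1) (m + 2) (d (m + 2)) = -d m) ∧
        (∀ m : ℕ, 1 ≤ m → ∀ P ∈ localLayerPointsOfEmb κ (closureEmb (K := ℚ) (v.adicCompletion ℚ)) A m,
          ∃ B ∈ AddSubgroup.closure (Set.range fun σ : Field.absoluteGaloisGroup (v.adicCompletion ℚ) ↦ σ • d m),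
            ∃ P' ∈ localLayerPointsOfEmb κ (closureEmb (K := ℚ) (v.adicCompletion ℚ)) A (m - 1),
            ∃ R ∈ localLayerPointsOfEmb κ (closureEmb (K := ℚ) (v.adicCompletion ℚ)) A m, P = B + P' + 2 • R) ∧
        (∀ P ∈ localLayerPointsOfEmb κ (closureEmb (K := ℚ) (v.adicCompletion ℚ)) A 0,
          ∃ a : ℤ, ∃ R ∈ localLayerPointsOfEmb κ (closureEmb (K := ℚ) (v.adicCompletion ℚ)) A 0, P = a • d 0 + 2 • R))
    (hup : ∀ (κ : ZpExtension ℚ 2) (γ : Field.absoluteGaloisGroup ℚ),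
      κ.IsCyclotomic → κ.IsTopGenerator γ → IsCyclotomicVariable 2 γ →
      ∀ [NeZero (A.conductorNorm ℤ)] (f : CuspForm (Gamma0 (A.conductorNorm ℤ)) 2),
        IsNewformOf A f → ∀ (ϖ : ℚ), (ϖ : ℝ) * A.realPeriodRat = plusPeriod f →
      ∀ (Lplus Lminus : IwasawaAlgebra 2), IsPollackPair f 2 Lplus Lminus →
      ∀ (D : SignedSelmerDualData A κ γ 1),
        ∃ (g : IwasawaAlgebra 2) (m m' : ℕ), D.charIdeal = Ideal.span {g} ∧
          PowerSeries.C ((2 : ℚ_[2]) ^ m') * iwasawaToPowerSeries 2 g =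
            PowerSeries.C ((2 : ℚ_[2]) ^ m * (ϖ : ℚ_[2])) * iwasawaToPowerSeries 2 (kobayashiL 1 Lplus Lminus))
    (hflat : ∀ [NeZero (A.conductorNorm ℤ)] (f : CuspForm (Gamma0 (A.conductorNorm ℤ)) 2),
      IsNewformOf A f → ∀ (Lplus Lminus : IwasawaAlgebra 2), IsPollackPair f 2 Lplus Lminus →
        ∃ n : ℕ, IsUnit (PowerSeries.coeff n (kobayashiL 1 Lplus Lminus))) :
    (∀ (κ : ZpExtension ℚ 2) (γ : Field.absoluteGaloisGroup ℚ), κ.IsCyclotomic → κ.IsTopGenerator γ →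
      ∀ D : SignedSelmerDualData A κ γ 1, Module.IsTorsion (IwasawaAlgebra 2) D.X ∧ D.mu = 0) ∧
    KobayashiMainConjecture A 2 1 :=
  signedMainConjectureCMTwoRankZero_at_of_local_of_upToTwoPower A hBF hmod hLrat hGZK h2 hC h412 hcork hP108 hWL hcm hr hss ha
    (localNonDivCMTwo_at (A := A)) (plusCyclicLayersCMTwo_at_of_honda hss hhonda) (plusLocKummerCMTwo_at_of_honda hss hhonda)
    hup hflat

end Summit.BirchSwinnertonDyer.BirchSwinnertonDyer.Theorems

end
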